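import Literature.MathematicalPhysics.QuantumLattice.ApproximateEigenvectorLemmas
import HarnessLib

/-!
# The uncertainty-principle inequality of Pitaevskii–Stringari (finite-dimensional form)

For a state `ψ` (any vector of a finite-dimensional Hilbert space) and ARBITRARY operators
`A`, `B`,

`⟨{A†, A}⟩ · ⟨{B†, B}⟩ ≥ |⟨[A†, B]⟩|²`,

where `{X, Y} = XY + YX`, `[X, Y] = XY - YX` and `⟨X⟩ = ⟨ψ, Xψ⟩`
[cite: Stringari1995, §2.2 eq. (8)] [cite: PitaevskiiStringari1991]. This is the `T = 0`
substitute for the Bogoliubov inequality: it is what turns an order parameter (a macroscopic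
commutator expectation) into a LOWER bound on fluctuations (`n(q) ≥ n₀/(4S(q)) - 1/2`,
Stringari's (9); the `1/q` law (11); absence of BEC / of continuous-symmetry breaking in one
dimension at `T = 0`). The proof is two Cauchy–Schwarz inequalities:
`|⟨A†B⟩ - ⟨BA†⟩| ≤ ‖Aψ‖‖Bψ‖ + ‖B†ψ‖‖A†ψ‖ ≤ (‖Aψ‖² + ‖A†ψ‖²)^{1/2} (‖Bψ‖² + ‖B†ψ‖²)^{1/2}`.

Everything is PROVED (no named facts). Matrices act by `mulVec`; the Euclidean norm is the
tree's `eucNorm` (`ApproximateEigenvectorLemmas`), whose Cauchy–Schwarz inequality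
`norm_star_dotProduct_le` is the only analytic input.

## Main statements (namespace `Literature.MathematicalPhysics.QuantumLattice`)

* `re_expect_conjTranspose_mul_self_eq_eucNorm_sq` / `re_expect_mul_conjTranspose_self_eq_eucNorm_sq` :
  `Re ⟨ψ, Aᴴ A ψ⟩ = ‖Aψ‖₂²`, `Re ⟨ψ, A Aᴴ ψ⟩ = ‖Aᴴψ‖₂²`.
* `norm_sq_expect_commutator_le` : the inequality (8) in the form
  `‖⟨ψ, (AᴴB - BAᴴ)ψ⟩‖² ≤ Re⟨ψ, (AᴴA + AAᴴ)ψ⟩ · Re⟨ψ, (BᴴB + BBᴴ)ψ⟩`.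
* `norm_sq_expect_commutator_div_le` : the solved form
  `‖⟨[A†,B]⟩‖² / Re⟨{B†,B}⟩ ≤ Re⟨{A†,A}⟩` (for `Re⟨{B†,B}⟩ > 0`).

## References

* [Stringari1995] S. Stringari, *Sum rules and Bose–Einstein condensation*, in: A. Griffin,
  D. W. Snoke, S. Stringari (eds.), Bose–Einstein Condensation, CUP 1995, pp. 86–98, §2.2 eq. (8)
  (held: book:griffin1995-bose-einstein-condensation, PDF p. 73).
* [PitaevskiiStringari1991] L. Pitaevskii, S. Stringari, *Uncertainty principle, quantum
  fluctuations, and broken symmetries*, J. Low Temp. Phys. 85 (1991) 377–388,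
  doi:10.1007/BF00682193.
-/

noncomputable section

open Matrix Complex

namespace Literature.MathematicalPhysics.QuantumLattice

variable {n : Type*} [Fintype n] [DecidableEq n]

omit [DecidableEq n] in
/-- `⟨ψ, (Aᴴ B) ψ⟩ = (Aψ)⋆ · (Bψ)`: moving `Aᴴ` onto the bra (a local copy of the one-line
lemma of `FreeFermiGasPairGramBounds`, kept private to avoid that file's fermionic imports).
[folklore] -/
private theorem bra_conjTranspose_mul (A B : Matrix n n ℂ) (ψ : n → ℂ) :
    star ψ ⬝ᵥ ((Aᴴ * B) *ᵥ ψ) = star (A *ᵥ ψ) ⬝ᵥ (B *ᵥ ψ) := by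
  rw [← mulVec_mulVec, dotProduct_mulVec, star_mulVec]

omit [DecidableEq n] in
/-- `Re ⟨ψ, Aᴴ A ψ⟩ = ‖Aψ‖₂²`. [folklore] -/
theorem re_expect_conjTranspose_mul_self_eq_eucNorm_sq (A : Matrix n n ℂ) (ψ : n → ℂ) :
    (star ψ ⬝ᵥ ((Aᴴ * A) *ᵥ ψ)).re = eucNorm (A *ᵥ ψ) ^ 2 := by
  rw [bra_conjTranspose_mul, eucNorm_sq]

omit [DecidableEq n] in
/-- `Re ⟨ψ, A Aᴴ ψ⟩ = ‖Aᴴψ‖₂²`. [folklore] -/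
theorem re_expect_mul_conjTranspose_self_eq_eucNorm_sq (A : Matrix n n ℂ) (ψ : n → ℂ) :
    (star ψ ⬝ᵥ ((A * Aᴴ) *ᵥ ψ)).re = eucNorm (Aᴴ *ᵥ ψ) ^ 2 := by
  have h := re_expect_conjTranspose_mul_self_eq_eucNorm_sq Aᴴ ψ
  rwa [conjTranspose_conjTranspose] at h

omit [DecidableEq n] in
/-- **The uncertainty-principle inequality** (Pitaevskii–Stringari): for any matrices `A`, `B`
and any vector `ψ`,
`|⟨ψ, (AᴴB - BAᴴ)ψ⟩|² ≤ Re⟨ψ, (AᴴA + AAᴴ)ψ⟩ · Re⟨ψ, (BᴴB + BBᴴ)ψ⟩`,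
i.e. `⟨{A†,A}⟩⟨{B†,B}⟩ ≥ |⟨[A†,B]⟩|²`. Proof: `|⟨A†B⟩ - ⟨BA†⟩| ≤ ‖Aψ‖‖Bψ‖ + ‖B†ψ‖‖A†ψ‖`
(Cauchy–Schwarz) and `(ab + b'a')² ≤ (a² + a'²)(b² + b'²)`.
[cite: Stringari1995, §2.2 eq. (8)] [cite: PitaevskiiStringari1991] -/
theorem norm_sq_expect_commutator_le (A B : Matrix n n ℂ) (ψ : n → ℂ) :
    ‖star ψ ⬝ᵥ ((Aᴴ * B - B * Aᴴ) *ᵥ ψ)‖ ^ 2 ≤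
      (star ψ ⬝ᵥ ((Aᴴ * A + A * Aᴴ) *ᵥ ψ)).re *
        (star ψ ⬝ᵥ ((Bᴴ * B + B * Bᴴ) *ᵥ ψ)).re := by
  -- the four vectors
  set a := A *ᵥ ψ with ha
  set a' := Aᴴ *ᵥ ψ with ha'
  set b := B *ᵥ ψ with hb
  set b' := Bᴴ *ᵥ ψ with hb'
  -- the commutator expectation as a difference of two inner products
  have hAB : star ψ ⬝ᵥ ((Aᴴ * B) *ᵥ ψ) = star a ⬝ᵥ b :=
    bra_conjTranspose_mul A B ψ
  have hBA : star ψ ⬝ᵥ ((B * Aᴴ) *ᵥ ψ) = star b' ⬝ᵥ a' := by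
    have h := bra_conjTranspose_mul Bᴴ Aᴴ ψ
    rwa [conjTranspose_conjTranspose] at h
  have hcomm : star ψ ⬝ᵥ ((Aᴴ * B - B * Aᴴ) *ᵥ ψ) = star a ⬝ᵥ b - star b' ⬝ᵥ a' := by
    rw [sub_mulVec, dotProduct_sub, hAB, hBA]
  -- the two anticommutator expectations as sums of squared norms
  have hAA : (star ψ ⬝ᵥ ((Aᴴ * A + A * Aᴴ) *ᵥ ψ)).re = eucNorm a ^ 2 + eucNorm a' ^ 2 := by
    rw [add_mulVec, dotProduct_add, Complex.add_re,
      re_expect_conjTranspose_mul_self_eq_eucNorm_sq,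
      re_expect_mul_conjTranspose_self_eq_eucNorm_sq]
  have hBB : (star ψ ⬝ᵥ ((Bᴴ * B + B * Bᴴ) *ᵥ ψ)).re = eucNorm b ^ 2 + eucNorm b' ^ 2 := by
    rw [add_mulVec, dotProduct_add, Complex.add_re,
      re_expect_conjTranspose_mul_self_eq_eucNorm_sq,
      re_expect_mul_conjTranspose_self_eq_eucNorm_sq]
  rw [hcomm, hAA, hBB]
  -- Cauchy–Schwarz twice
  have h1 : ‖star a ⬝ᵥ b - star b' ⬝ᵥ a'‖ ≤
      eucNorm a * eucNorm b + eucNorm b' * eucNorm a' :=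
    (norm_sub_le _ _).trans (add_le_add (norm_star_dotProduct_le a b)
      (norm_star_dotProduct_le b' a'))
  have h0 : 0 ≤ ‖star a ⬝ᵥ b - star b' ⬝ᵥ a'‖ := norm_nonneg _
  have ha0 := eucNorm_nonneg a
  have ha'0 := eucNorm_nonneg a'
  have hb0 := eucNorm_nonneg b
  have hb'0 := eucNorm_nonneg b'
  have h2 : ‖star a ⬝ᵥ b - star b' ⬝ᵥ a'‖ ^ 2 ≤
      (eucNorm a * eucNorm b + eucNorm b' * eucNorm a') ^ 2 :=
    pow_le_pow_left₀ h0 h1 2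
  -- `(ab + b'a')² ≤ (a² + a'²)(b² + b'²)` since the difference is `(ab' - a'b)²`
  nlinarith [sq_nonneg (eucNorm a * eucNorm b' - eucNorm a' * eucNorm b),
    mul_nonneg ha0 hb0, mul_nonneg hb'0 ha'0]

omit [DecidableEq n] in
/-- **The uncertainty-principle inequality, solved for the fluctuation of `A`**: if
`Re⟨ψ, (BᴴB + BBᴴ)ψ⟩ > 0` then
`|⟨ψ, (AᴴB - BAᴴ)ψ⟩|² / Re⟨ψ, (BᴴB + BBᴴ)ψ⟩ ≤ Re⟨ψ, (AᴴA + AAᴴ)ψ⟩` — the form in which an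
order parameter in `⟨[A†,B]⟩` bounds the fluctuation `⟨{A†,A}⟩` from below (Stringari's (9)).
[cite: Stringari1995, §2.2 eqs. (8)–(9)] [cite: PitaevskiiStringari1991] -/
theorem norm_sq_expect_commutator_div_le (A B : Matrix n n ℂ) (ψ : n → ℂ)
    (hB : 0 < (star ψ ⬝ᵥ ((Bᴴ * B + B * Bᴴ) *ᵥ ψ)).re) :
    ‖star ψ ⬝ᵥ ((Aᴴ * B - B * Aᴴ) *ᵥ ψ)‖ ^ 2 / (star ψ ⬝ᵥ ((Bᴴ * B + B * Bᴴ) *ᵥ ψ)).re ≤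
      (star ψ ⬝ᵥ ((Aᴴ * A + A * Aᴴ) *ᵥ ψ)).re := by
  rw [div_le_iff₀ hB]
  exact norm_sq_expect_commutator_le A B ψ

end Literature.MathematicalPhysics.QuantumLattice
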